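/- Free-seat work of EXTRA WIDTH SEAT `ym-line-cbag-p1-w5` (prover-ym-line-cbag-p1-w5-g2-0), route `EguchiKawaiDirectionLadder`
(ideator ym-idea-2, LINE 8), crux `TripleSmallBallMargin` (stmt-QuantumFields-27724): PRICING AN EGUCHI–KAWAI EVENT BY THE EIGENANGLES OF
ITS FIRST LINK — Weyl's integration formula (named fact `Literature.Probability.RandomMatrix.WeylIntegrationFormulaUN`; typed in
`Literature/Probability/RandomMatrix/WeylIntegrationFormula.lean`; PROVED in the tree in pushforward form as
`weylIntegralFormula_unitary_holds`, the discharge `…_holds` of the named fact being width seat w4's) applied to the first-link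
disintegration and class-function reduction of width seat w4's `EguchiKawaiDirectionLadderFirstLinkFibre`.  CONDITIONAL on the named fact
(hypothesis `hW`).  Route-independent.  Nothing here bears on the Yang–Mills mass gap (barrier-ledger line onto `EguchiKawaiBreakdown`). -/
import Literature.Probability.RandomMatrix.WeylIntegrationFormula
import Summits.QuantumFields.YangMills.Theorems.EguchiKawaiDirectionLadderFirstLinkFibre
import Summits.QuantumFields.YangMills.Theorems.EguchiKawaiDirectionLadderSpectralWindowLaw

/-!
# Route `EguchiKawaiDirectionLadder`: the law of an EK configuration conditioned on the spectrum of its first link (Weyl pricing)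

For a measurable event `E ⊆ U(N)^{d+1}` invariant under SIMULTANEOUS conjugation `U ↦ (V U_α V⁻¹)_α`:

* `measurable_ekHaar_fibre_head` — the fibre probability `U₀ ↦ ekHaar d N {W | (U₀, W) ∈ E}` is measurable (`(U₀, W)` = `Fin.cons U₀ W`);
  by `firstFibre_conj` (w4) it is a class function of `U₀`, and by `ekHaar_succ_eq_lintegral_firstFibre` (w4) its Haar integral is
  `ekHaar (d+1) N E`;
* `ekHaar_succ_apply_eq_weyl` — hence, CONDITIONALLY on Weyl's integration formula for `U(N)`,
  `ekHaar (d+1) N E = (N!(2π)^N)⁻¹ ∫_{[−π,π]^N} ∏_{j<k}|e^{iθ_j} − e^{iθ_k}|² · ekHaar d N {W | (diag(e^{iθ}), W) ∈ E} dθ`;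
* `ekHaar_succ_apply_le_weyl_flat` — and the `e^{O(N²)}`-flat form
  `ekHaar (d+1) N E ≤ (N!(2π)^N)⁻¹ 4^{N(N−1)/2} ∫_{[−π,π]^N} ekHaar d N {W | (diag(e^{iθ}), W) ∈ E} dθ`
  (the remaining links then face a DIAGONAL first link with prescribed eigenangles, where the entrywise identity
  `‖[diag(d), W]‖_F² = Σ_{jk} |d_j − d_k|² |W_jk|²` — w2's `frobSq_diagonal_comm` — applies).

The events of LINE 8 (`{S_R ≤ t}`, `Sym_δ ∩ {S_R ≤ t}`, their intersections with spectral windows of `U 0`) are conjugation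
invariant (`ekAction_conj`, `symSmallBall_conj_invariant`, `SpectralWindow.charpoly_unitary_conj`).
-/

set_option autoImplicit false

noncomputable section

open MeasureTheory
open scoped ENNReal Real
open Literature.Barriers.QuantumFields

namespace Summit.QuantumFields.YangMills.Theorems.EguchiKawaiDirectionLadder

open Literature.Probability.RandomMatrix (WeylIntegrationFormulaUN)
open Literature.MathematicalPhysics.QuantumFieldTheory (haarProbability)
open Literature.LinearAlgebra.Matrix (diagonalTorusHom)

variable {d N : ℕ}

/-- The fibre probability `U₀ ↦ ekHaar d N {W | (U₀, W) ∈ E}` is a measurable function of the first link. -/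
theorem measurable_ekHaar_fibre_head {E : Set (EKConfig (d + 1) N)} (hE : MeasurableSet E) :
    Measurable fun U₀ : UN N => ekHaar d N {W : EKConfig d N | (Fin.cons U₀ W : EKConfig (d + 1) N) ∈ E} := by
  set e := MeasurableEquiv.piFinSuccAbove (fun _ : Fin (d + 1) => UN N) 0 with he
  have hpre : MeasurableSet (e.symm ⁻¹' E) := e.symm.measurable hE
  have hfun : (fun U₀ : UN N => ekHaar d N {W : EKConfig d N | (Fin.cons U₀ W : EKConfig (d + 1) N) ∈ E}) =
      fun U₀ : UN N => ekHaar d N (Prod.mk U₀ ⁻¹' (e.symm ⁻¹' E)) := by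
    funext U₀
    congr 1
    ext W
    simp only [Set.mem_preimage, Set.mem_setOf_eq, he, piFinSuccAbove_zero_symm_apply]
  rw [hfun]
  exact measurable_measure_prodMk_left hpre

/-- **Pricing an event by the eigenangles of the first link** (CONDITIONAL on Weyl's integration formula for `U(N)`):
for a measurable event `E ⊆ U(N)^{d+1}` invariant under simultaneous conjugation,
`ekHaar (d+1) N E = (N!(2π)^N)⁻¹ ∫_{[−π,π]^N} ∏_{j<k}|e^{iθ_j} − e^{iθ_k}|² · ekHaar d N {W | (diag(e^{iθ}), W) ∈ E} dθ`. -/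
theorem ekHaar_succ_apply_eq_weyl (hW : WeylIntegrationFormulaUN) {E : Set (EKConfig (d + 1) N)}
    (hE : MeasurableSet E)
    (hconj : ∀ (V : UN N) (U : EKConfig (d + 1) N), U ∈ E → (fun α => V * U α * V⁻¹) ∈ E) :
    ekHaar (d + 1) N E =
      ENNReal.ofReal (((2 * π) ^ N * (N.factorial : ℝ))⁻¹) *
        ∫⁻ θ in Set.pi Set.univ (fun _ : Fin N => Set.Icc (-π) π),
          ENNReal.ofReal (∏ j : Fin N, ∏ k ∈ Finset.Ioi j,
              ‖Complex.exp (θ j * Complex.I) - Complex.exp (θ k * Complex.I)‖ ^ 2) *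
            ekHaar d N {W : EKConfig d N |
              (Fin.cons (diagonalTorusHom (Fin N) fun j => Circle.exp (θ j)) W : EKConfig (d + 1) N) ∈ E} := by
  rw [ekHaar_succ_eq_lintegral_firstFibre hE]
  exact hW N _ (measurable_ekHaar_fibre_head hE) (fun U₀ V => firstFibre_conj hE hconj V U₀)

/-- **Flat first-link window law** (CONDITIONAL on Weyl's integration formula): for a measurable event invariant under
simultaneous conjugation,
`ekHaar (d+1) N E ≤ (N!(2π)^N)⁻¹ · 4^{N(N−1)/2} · ∫_{[−π,π]^N} ekHaar d N {W | (diag(e^{iθ}), W) ∈ E} dθ` — the spectrum of the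
first link costs at most `e^{O(N²)}` more than independent uniform eigenangles, and the other links then face a DIAGONAL
first link. -/
theorem ekHaar_succ_apply_le_weyl_flat (hW : WeylIntegrationFormulaUN) {E : Set (EKConfig (d + 1) N)}
    (hE : MeasurableSet E)
    (hconj : ∀ (V : UN N) (U : EKConfig (d + 1) N), U ∈ E → (fun α => V * U α * V⁻¹) ∈ E) :
    ekHaar (d + 1) N E ≤
      ENNReal.ofReal (((2 * π) ^ N * (N.factorial : ℝ))⁻¹ * (4 : ℝ) ^ (N * (N - 1) / 2)) *
        ∫⁻ θ in Set.pi Set.univ (fun _ : Fin N => Set.Icc (-π) π),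
          ekHaar d N {W : EKConfig d N |
            (Fin.cons (diagonalTorusHom (Fin N) fun j => Circle.exp (θ j)) W : EKConfig (d + 1) N) ∈ E} := by
  rw [ekHaar_succ_apply_eq_weyl hW hE hconj]
  set box : Set (Fin N → ℝ) := Set.pi Set.univ (fun _ : Fin N => Set.Icc (-π) π)
  set F : (Fin N → ℝ) → ℝ≥0∞ := fun θ => ekHaar d N {W : EKConfig d N |
    (Fin.cons (diagonalTorusHom (Fin N) fun j => Circle.exp (θ j)) W : EKConfig (d + 1) N) ∈ E}
  have hpt : ∀ θ : Fin N → ℝ,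
      ENNReal.ofReal (∏ j : Fin N, ∏ k ∈ Finset.Ioi j,
          ‖Complex.exp (θ j * Complex.I) - Complex.exp (θ k * Complex.I)‖ ^ 2) * F θ ≤
        ENNReal.ofReal ((4 : ℝ) ^ (N * (N - 1) / 2)) * F θ := fun θ =>
    mul_le_mul' (ENNReal.ofReal_le_ofReal (SpectralWindow.vandermondeCircleWeight_le N θ)) le_rfl
  calc ENNReal.ofReal (((2 * π) ^ N * (N.factorial : ℝ))⁻¹) *
        ∫⁻ θ in box, ENNReal.ofReal (∏ j : Fin N, ∏ k ∈ Finset.Ioi j,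
            ‖Complex.exp (θ j * Complex.I) - Complex.exp (θ k * Complex.I)‖ ^ 2) * F θ
      ≤ ENNReal.ofReal (((2 * π) ^ N * (N.factorial : ℝ))⁻¹) *
          ∫⁻ θ in box, ENNReal.ofReal ((4 : ℝ) ^ (N * (N - 1) / 2)) * F θ :=
        mul_le_mul' le_rfl (lintegral_mono fun θ => hpt θ)
    _ = ENNReal.ofReal (((2 * π) ^ N * (N.factorial : ℝ))⁻¹) *
          (ENNReal.ofReal ((4 : ℝ) ^ (N * (N - 1) / 2)) * ∫⁻ θ in box, F θ) := by
        rw [lintegral_const_mul' _ _ ENNReal.ofReal_ne_top]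
    _ = ENNReal.ofReal (((2 * π) ^ N * (N.factorial : ℝ))⁻¹ * (4 : ℝ) ^ (N * (N - 1) / 2)) *
          ∫⁻ θ in box, F θ := by
        rw [← mul_assoc, ← ENNReal.ofReal_mul (by positivity)]

end Summit.QuantumFields.YangMills.Theorems.EguchiKawaiDirectionLadder

end
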